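import Summits.QuantumAdvantage.QuantumAdvantage.Theorems.HolonomyDialChain

/-!
# HolonomyDial — AvoidHard (cell decomp-qadv, seat lens-2, generation 13; supports item 26531 `ExactnessDial.PolyLossOddU3`)

§H part 4: `q_bound`, `sum_card_compat_le`, `card_nav_le`, **`avoid_count`** (`2^{N-1} ≤ 32·#{x odd : L x = hol x}`), `hK_of_sq`, `exists_split4`, `avoid_hard_polylog`, **`holAvoidLoss3 : HolAvoidLoss3`**, `polyLossOddU3_iff_avoidLift3`, `dial_levels_proved`.

Split (≤ 400 lines, part 11/11) of the node file `HOME/decomp-qadv-lens-2/g13/HolonomyDial.lean` (v5, sha256 fb2c0281…,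
farm rc 0, no placeholders); declarations verbatim, namespace `Summit.QuantumAdvantage.QuantumAdvantage.Theorems.HolonomyDial`.
Record: NODE-g13.md.
-/

set_option linter.dupNamespace false

noncomputable section
open scoped Classical

namespace Summit.QuantumAdvantage.QuantumAdvantage.Theorems

open Finset
open Literature.Computability.QuantumComplexity Literature.Computability.QuantumComplexity.RingHLF
open Literature.Computability.MetaComplexity Literature.Computability.MetaComplexity.Smolensky
open Summit.QuantumAdvantage.AdviceFreeQNC0
open Summit.QuantumAdvantage.QuantumAdvantage.Theses (ExactnessDial.PolyLossOddU3 ExactnessDial.NoPerfectOdd3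
  ExactnessDial.NoPerfectConst3 ExactnessDial.MassStep3u ExactnessDial.OddToAll3 ExactnessDial.DPLift3
  ExactnessDial.MultiRingBridge3 ExactnessDial.closes)

namespace HolonomyDial

section AvoidHard

variable {N : ℕ}

/-! ### H7. summing up: the avoidance theorem -/

section Final

variable (m : ℕ) (L : CubeFn (ZMod 3) N)

/-- per event `q`: `4096·N_q ≤ 512·|E_q ∩ odd| + 30·2^N`. -/
theorem q_bound {D : ℕ} (h4m : 4 * m ≤ N) (hm : Odd m) (hm3 : 3 ≤ m)
    (hK : 512 * ((8 * D + 8 * D) * m.choose (m / 2)) ≤ 2 ^ m)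
    (hL : L ∈ lowDeg (ZMod 3) N D) (q : Bool × Bool × Bool) :
    4096 * (univ.filter fun x : Fin N → Bool => OddZeros x ∧ q ∈ compatSet (dat m L x) ∧
        (zb m 1 x, zb m 2 x, zb m 3 x) = q).card ≤
      512 * (univ.filter fun x : Fin N → Bool => OddZeros x ∧ q ∈ compatSet (dat m L x)).card + 30 * 2 ^ N := by
  have hp := pattern_bound m L h4m hm hm3 hK hL q 1 (Or.inl rfl)
  have hn := pattern_bound m L h4m hm hm3 hK hL q (-1) (Or.inr rfl)
  have hN : (univ.filter fun x : Fin N → Bool => OddZeros x ∧ q ∈ compatSet (dat m L x) ∧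
        (zb m 1 x, zb m 2 x, zb m 3 x) = q).card ≤
      (univ.filter fun x : Fin N → Bool => OddZeros x ∧ q ∈ compatSet (dat m L x) ∧
        (zb m 1 x, zb m 2 x, zb m 3 x) = q ∧ bsgn (4 * m) (N - 4 * m) x = 1).card +
      (univ.filter fun x : Fin N → Bool => OddZeros x ∧ q ∈ compatSet (dat m L x) ∧
        (zb m 1 x, zb m 2 x, zb m 3 x) = q ∧ bsgn (4 * m) (N - 4 * m) x = -1).card := by
    refine le_trans (card_le_card fun x hx => ?_) (Finset.card_union_le _ _)
    rw [mem_filter] at hx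
    rw [mem_union, mem_filter, mem_filter]
    rcases bsgn_cases (4 * m) (N - 4 * m) x with h | h
    · exact Or.inl ⟨mem_univ _, hx.2.1, hx.2.2.1, hx.2.2.2, h⟩
    · exact Or.inr ⟨mem_univ _, hx.2.1, hx.2.2.1, hx.2.2.2, h⟩
  have key : ∀ {x : Fin N → Bool}, eInd m L q x = 1 → q ∈ compatSet (dat m L x) := by
    intro x h
    rw [eInd_apply] at h
    by_contra hq
    rw [if_neg hq] at h
    exact zero_ne_one h
  have hM : (univ.filter fun x : Fin N → Bool =>
        eInd m L q x = 1 ∧ bsgn (4 * m) (N - 4 * m) x = 1 ∧ OddZeros x).card +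
      (univ.filter fun x : Fin N → Bool =>
        eInd m L q x = 1 ∧ bsgn (4 * m) (N - 4 * m) x = -1 ∧ OddZeros x).card ≤
      (univ.filter fun x : Fin N → Bool => OddZeros x ∧ q ∈ compatSet (dat m L x)).card := by
    rw [← Finset.card_union_of_disjoint (Finset.disjoint_filter.2 fun x _ h1 h2 => by
      have := h1.2.1.symm.trans h2.2.1; exact absurd this (by decide))]
    refine card_le_card fun x hx => ?_
    rw [mem_union, mem_filter, mem_filter] at hx
    rw [mem_filter]
    rcases hx with ⟨_, h1, _, h3⟩ | ⟨_, h1, _, h3⟩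
    · exact ⟨mem_univ _, h3, key h1⟩
    · exact ⟨mem_univ _, h3, key h1⟩
  omega

/-- exchange of summation and the CORE: `Σ_q |E_q ∩ odd| = Σ_{x odd} |A(data x)| ≤ 6·#odd`. -/
theorem sum_card_compat_le :
    ∑ q : Bool × Bool × Bool, (univ.filter fun x : Fin N → Bool => OddZeros x ∧ q ∈ compatSet (dat m L x)).card ≤
      6 * (univ.filter fun x : Fin N → Bool => OddZeros x).card := by
  have e : ∀ q : Bool × Bool × Bool,
      (univ.filter fun x : Fin N → Bool => OddZeros x ∧ q ∈ compatSet (dat m L x)).card =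
        ∑ x : Fin N → Bool, (if OddZeros x ∧ q ∈ compatSet (dat m L x) then 1 else 0) :=
    fun q => Finset.card_filter _ _
  rw [Finset.sum_congr rfl fun q _ => e q, Finset.sum_comm]
  have hx : ∀ x : Fin N → Bool,
      ∑ q : Bool × Bool × Bool, (if OddZeros x ∧ q ∈ compatSet (dat m L x) then 1 else 0) ≤
        if OddZeros x then 6 else 0 := by
    intro x
    by_cases ho : OddZeros x
    · rw [if_pos ho]
      have e2 := Finset.card_filter (fun q : Bool × Bool × Bool => OddZeros x ∧ q ∈ compatSet (dat m L x)) univ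
      rw [← e2]
      have e3 : (univ.filter fun q : Bool × Bool × Bool => OddZeros x ∧ q ∈ compatSet (dat m L x)) =
          compatSet (dat m L x) := by
        ext q
        rw [mem_filter]
        exact ⟨fun h => h.2.2, fun h => ⟨mem_univ _, ho, h⟩⟩
      rw [e3]
      exact core_le_six _
    · rw [if_neg ho]
      apply le_of_eq
      apply Finset.sum_eq_zero
      intro q _
      rw [if_neg (fun h => ho h.1)]
  have hf := Finset.sum_filter (s := (univ : Finset (Fin N → Bool))) (p := fun x : Fin N → Bool => OddZeros x)
    (f := fun _ => (6 : ℕ))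
  calc ∑ x : Fin N → Bool, ∑ q : Bool × Bool × Bool, (if OddZeros x ∧ q ∈ compatSet (dat m L x) then 1 else 0)
      ≤ ∑ x : Fin N → Bool, (if OddZeros x then 6 else 0) := Finset.sum_le_sum fun x _ => hx x
    _ = 6 * (univ.filter fun x : Fin N → Bool => OddZeros x).card := by
      rw [← hf, Finset.sum_const, smul_eq_mul, mul_comm]

/-- `card_filter_flip2` with free decidability instances (the chart lemma is stated classically). -/
theorem card_filter_flip2' {a b : ℕ} (hab : a < b) (hbN : b < N) (P : (Fin N → Bool) → Prop)
    [DecidablePred (fun x : Fin N → Bool => OddZeros x ∧ P (flip2 a b x))]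
    [DecidablePred (fun x : Fin N → Bool => OddZeros x ∧ P x)] :
    (univ.filter fun x : Fin N → Bool => OddZeros x ∧ P (flip2 a b x)).card =
      (univ.filter fun x : Fin N → Bool => OddZeros x ∧ P x).card := by
  convert card_filter_flip2 hab hbN P

/-- the odd inputs NOT fully avoided on the orbit are covered by four translates of the agreement set. -/
theorem card_nav_le (hm1 : 1 ≤ m) (h3N : 3 * m < N) :
    (univ.filter fun x : Fin N → Bool => OddZeros x ∧ ¬ (L x ≠ ((hol x : ℕ) : ZMod 3) ∧
        L (fl m 3 x) ≠ ((hol (fl m 3 x) : ℕ) : ZMod 3) ∧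
        L (fl m 1 (fl m 2 x)) ≠ ((hol (fl m 1 (fl m 2 x)) : ℕ) : ZMod 3) ∧
        L (fl m 1 (fl m 2 (fl m 3 x))) ≠ ((hol (fl m 1 (fl m 2 (fl m 3 x))) : ℕ) : ZMod 3))).card ≤
      4 * (univ.filter fun x : Fin N → Bool => OddZeros x ∧ L x = ((hol x : ℕ) : ZMod 3)).card := by
  have c3 : (univ.filter fun x : Fin N → Bool => OddZeros x ∧ L (fl m 3 x) = ((hol (fl m 3 x) : ℕ) : ZMod 3)).card = (univ.filter fun x : Fin N → Bool => OddZeros x ∧ L x = ((hol x : ℕ) : ZMod 3)).card :=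
    card_filter_flip2' (a := 3 * m - 1) (b := 3 * m) (by omega) (by omega) (fun y => L y = ((hol y : ℕ) : ZMod 3))
  have c12 : (univ.filter fun x : Fin N → Bool => OddZeros x ∧
          L (fl m 1 (fl m 2 x)) = ((hol (fl m 1 (fl m 2 x)) : ℕ) : ZMod 3)).card = (univ.filter fun x : Fin N → Bool => OddZeros x ∧ L x = ((hol x : ℕ) : ZMod 3)).card :=
    (card_filter_flip2' (a := 2 * m - 1) (b := 2 * m) (by omega) (by omega)
      (fun y => L (fl m 1 y) = ((hol (fl m 1 y) : ℕ) : ZMod 3))).trans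
    (card_filter_flip2' (a := 1 * m - 1) (b := 1 * m) (by omega) (by omega) (fun y => L y = ((hol y : ℕ) : ZMod 3)))
  have c123 : (univ.filter fun x : Fin N → Bool => OddZeros x ∧
          L (fl m 1 (fl m 2 (fl m 3 x))) = ((hol (fl m 1 (fl m 2 (fl m 3 x))) : ℕ) : ZMod 3)).card = (univ.filter fun x : Fin N → Bool => OddZeros x ∧ L x = ((hol x : ℕ) : ZMod 3)).card :=
    (card_filter_flip2' (a := 3 * m - 1) (b := 3 * m) (by omega) (by omega)
      (fun y => L (fl m 1 (fl m 2 y)) = ((hol (fl m 1 (fl m 2 y)) : ℕ) : ZMod 3))).trans c12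
  have hcov : (univ.filter fun x : Fin N → Bool => OddZeros x ∧ ¬ (L x ≠ ((hol x : ℕ) : ZMod 3) ∧
        L (fl m 3 x) ≠ ((hol (fl m 3 x) : ℕ) : ZMod 3) ∧
        L (fl m 1 (fl m 2 x)) ≠ ((hol (fl m 1 (fl m 2 x)) : ℕ) : ZMod 3) ∧
        L (fl m 1 (fl m 2 (fl m 3 x))) ≠ ((hol (fl m 1 (fl m 2 (fl m 3 x))) : ℕ) : ZMod 3))) ⊆
      (univ.filter fun x : Fin N → Bool => OddZeros x ∧ L x = ((hol x : ℕ) : ZMod 3)) ∪ (univ.filter fun x : Fin N → Bool => OddZeros x ∧ L (fl m 3 x) = ((hol (fl m 3 x) : ℕ) : ZMod 3)) ∪ (univ.filter fun x : Fin N → Bool => OddZeros x ∧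
          L (fl m 1 (fl m 2 x)) = ((hol (fl m 1 (fl m 2 x)) : ℕ) : ZMod 3)) ∪ (univ.filter fun x : Fin N → Bool => OddZeros x ∧
          L (fl m 1 (fl m 2 (fl m 3 x))) = ((hol (fl m 1 (fl m 2 (fl m 3 x))) : ℕ) : ZMod 3)) := by
    intro x hx
    rw [mem_filter] at hx
    obtain ⟨_, hodd, hnot⟩ := hx
    rw [mem_union, mem_union, mem_union, mem_filter, mem_filter, mem_filter, mem_filter]
    by_cases e0 : L x = ((hol x : ℕ) : ZMod 3)
    · exact Or.inl (Or.inl (Or.inl ⟨mem_univ _, hodd, e0⟩))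
    by_cases e3 : L (fl m 3 x) = ((hol (fl m 3 x) : ℕ) : ZMod 3)
    · exact Or.inl (Or.inl (Or.inr ⟨mem_univ _, hodd, e3⟩))
    by_cases e12 : L (fl m 1 (fl m 2 x)) = ((hol (fl m 1 (fl m 2 x)) : ℕ) : ZMod 3)
    · exact Or.inl (Or.inr ⟨mem_univ _, hodd, e12⟩)
    by_cases e123 : L (fl m 1 (fl m 2 (fl m 3 x))) = ((hol (fl m 1 (fl m 2 (fl m 3 x))) : ℕ) : ZMod 3)
    · exact Or.inr ⟨mem_univ _, hodd, e123⟩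
    exact absurd ⟨e0, e3, e12, e123⟩ hnot
  calc (univ.filter fun x : Fin N → Bool => OddZeros x ∧ ¬ (L x ≠ ((hol x : ℕ) : ZMod 3) ∧
        L (fl m 3 x) ≠ ((hol (fl m 3 x) : ℕ) : ZMod 3) ∧
        L (fl m 1 (fl m 2 x)) ≠ ((hol (fl m 1 (fl m 2 x)) : ℕ) : ZMod 3) ∧
        L (fl m 1 (fl m 2 (fl m 3 x))) ≠ ((hol (fl m 1 (fl m 2 (fl m 3 x))) : ℕ) : ZMod 3))).card
      ≤ ((univ.filter fun x : Fin N → Bool => OddZeros x ∧ L x = ((hol x : ℕ) : ZMod 3)) ∪ (univ.filter fun x : Fin N → Bool => OddZeros x ∧ L (fl m 3 x) = ((hol (fl m 3 x) : ℕ) : ZMod 3)) ∪ (univ.filter fun x : Fin N → Bool => OddZeros x ∧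
          L (fl m 1 (fl m 2 x)) = ((hol (fl m 1 (fl m 2 x)) : ℕ) : ZMod 3)) ∪ (univ.filter fun x : Fin N → Bool => OddZeros x ∧
          L (fl m 1 (fl m 2 (fl m 3 x))) = ((hol (fl m 1 (fl m 2 (fl m 3 x))) : ℕ) : ZMod 3))).card := card_le_card hcov
    _ ≤ (univ.filter fun x : Fin N → Bool => OddZeros x ∧ L x = ((hol x : ℕ) : ZMod 3)).card + (univ.filter fun x : Fin N → Bool => OddZeros x ∧ L (fl m 3 x) = ((hol (fl m 3 x) : ℕ) : ZMod 3)).card + (univ.filter fun x : Fin N → Bool => OddZeros x ∧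
          L (fl m 1 (fl m 2 x)) = ((hol (fl m 1 (fl m 2 x)) : ℕ) : ZMod 3)).card + (univ.filter fun x : Fin N → Bool => OddZeros x ∧
          L (fl m 1 (fl m 2 (fl m 3 x))) = ((hol (fl m 1 (fl m 2 (fl m 3 x))) : ℕ) : ZMod 3)).card := by
      refine le_trans (Finset.card_union_le _ _) (Nat.add_le_add_right ?_ _)
      refine le_trans (Finset.card_union_le _ _) (Nat.add_le_add_right ?_ _)
      exact Finset.card_union_le _ _
    _ = 4 * (univ.filter fun x : Fin N → Bool => OddZeros x ∧ L x = ((hol x : ℕ) : ZMod 3)).card := by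
      rw [c3, c12, c123]; ring

/-- **THE COUNT**: a degree-`D` polynomial with `2^26·D² ≤ m`, `4m ≤ N` AGREES with the holonomy on at least
`2^{N-1}/32` odd inputs. -/
theorem avoid_count {D : ℕ} (h4m : 4 * m ≤ N) (hm : Odd m) (hm3 : 3 ≤ m)
    (hK : 512 * ((8 * D + 8 * D) * m.choose (m / 2)) ≤ 2 ^ m) (hL : L ∈ lowDeg (ZMod 3) N D) :
    2 ^ (N - 1) ≤ 32 * (univ.filter fun x : Fin N → Bool => OddZeros x ∧ L x = ((hol x : ℕ) : ZMod 3)).card := by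
  have hq := Finset.sum_le_sum fun q (_ : q ∈ (univ : Finset (Bool × Bool × Bool))) => q_bound m L h4m hm hm3 hK hL q
  simp only [Finset.sum_const, Finset.card_univ, Fintype.card_prod, Fintype.card_bool, smul_eq_mul,
    Finset.sum_add_distrib, ← Finset.mul_sum] at hq
  have h6 := sum_card_compat_le m L
  have hcov : (univ.filter fun x : Fin N → Bool => OddZeros x ∧
        (zb m 1 x, zb m 2 x, zb m 3 x) ∈ compatSet (dat m L x)).card ≤
      ∑ q : Bool × Bool × Bool, (univ.filter fun x : Fin N → Bool => OddZeros x ∧ q ∈ compatSet (dat m L x) ∧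
        (zb m 1 x, zb m 2 x, zb m 3 x) = q).card := by
    refine le_trans (card_le_card fun x hx => ?_) Finset.card_biUnion_le
    rw [mem_filter] at hx
    rw [Finset.mem_biUnion]
    refine ⟨(zb m 1 x, zb m 2 x, zb m 3 x), mem_univ _, ?_⟩
    rw [mem_filter]
    exact ⟨mem_univ _, hx.2.1, hx.2.2, rfl⟩
  have hav : (univ.filter fun x : Fin N → Bool => OddZeros x ∧ (L x ≠ ((hol x : ℕ) : ZMod 3) ∧
        L (fl m 3 x) ≠ ((hol (fl m 3 x) : ℕ) : ZMod 3) ∧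
        L (fl m 1 (fl m 2 x)) ≠ ((hol (fl m 1 (fl m 2 x)) : ℕ) : ZMod 3) ∧
        L (fl m 1 (fl m 2 (fl m 3 x))) ≠ ((hol (fl m 1 (fl m 2 (fl m 3 x))) : ℕ) : ZMod 3))).card ≤
      (univ.filter fun x : Fin N → Bool => OddZeros x ∧
        (zb m 1 x, zb m 2 x, zb m 3 x) ∈ compatSet (dat m L x)).card := by
    refine card_le_card fun x hx => ?_
    rw [mem_filter] at hx ⊢
    exact ⟨mem_univ _, hx.2.1, mem_compatSet_of_avoid (m := m) (L := L) (by omega) (by omega) x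
      hx.2.2.1 hx.2.2.2.1 hx.2.2.2.2.1 hx.2.2.2.2.2⟩
  have hsplit : (univ.filter fun x : Fin N → Bool => OddZeros x).card ≤
      (univ.filter fun x : Fin N → Bool => OddZeros x ∧ (L x ≠ ((hol x : ℕ) : ZMod 3) ∧
        L (fl m 3 x) ≠ ((hol (fl m 3 x) : ℕ) : ZMod 3) ∧
        L (fl m 1 (fl m 2 x)) ≠ ((hol (fl m 1 (fl m 2 x)) : ℕ) : ZMod 3) ∧
        L (fl m 1 (fl m 2 (fl m 3 x))) ≠ ((hol (fl m 1 (fl m 2 (fl m 3 x))) : ℕ) : ZMod 3))).card +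
      (univ.filter fun x : Fin N → Bool => OddZeros x ∧ ¬ (L x ≠ ((hol x : ℕ) : ZMod 3) ∧
        L (fl m 3 x) ≠ ((hol (fl m 3 x) : ℕ) : ZMod 3) ∧
        L (fl m 1 (fl m 2 x)) ≠ ((hol (fl m 1 (fl m 2 x)) : ℕ) : ZMod 3) ∧
        L (fl m 1 (fl m 2 (fl m 3 x))) ≠ ((hol (fl m 1 (fl m 2 (fl m 3 x))) : ℕ) : ZMod 3))).card := by
    refine le_trans (card_le_card fun x hx => ?_) (Finset.card_union_le _ _)
    rw [mem_filter] at hx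
    rw [mem_union, mem_filter, mem_filter]
    by_cases h : (L x ≠ ((hol x : ℕ) : ZMod 3) ∧
        L (fl m 3 x) ≠ ((hol (fl m 3 x) : ℕ) : ZMod 3) ∧
        L (fl m 1 (fl m 2 x)) ≠ ((hol (fl m 1 (fl m 2 x)) : ℕ) : ZMod 3) ∧
        L (fl m 1 (fl m 2 (fl m 3 x))) ≠ ((hol (fl m 1 (fl m 2 (fl m 3 x))) : ℕ) : ZMod 3))
    · exact Or.inl ⟨mem_univ _, hx.2, h⟩
    · exact Or.inr ⟨mem_univ _, hx.2, h⟩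
  have hnav := card_nav_le m L (by omega) (by omega)
  have hodd_lo : 2 ^ (N - 1) ≤ (univ.filter fun x : Fin N → Bool => OddZeros x).card := by
    obtain ⟨k, hk⟩ : ∃ k, N = k + 1 := ⟨N - 1, by omega⟩
    subst hk
    rw [Nat.add_sub_cancel]
    exact Theorems.ExactnessDialOddToAll.two_pow_le_card_odd
  have hodd_hi := card_odd_le (n := N) (by omega)
  have hE : 2 ^ N = 2 * 2 ^ (N - 1) := by
    obtain ⟨k, hk⟩ : ∃ k, N = k + 1 := ⟨N - 1, by omega⟩
    rw [hk, Nat.add_sub_cancel, pow_succ]; ring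
  omega

/-- the degree budget: `2^26·D'² ≤ m` gives `512·(16 D')·C(m, m/2) ≤ 2^m` (central binomial bound). -/
theorem hK_of_sq {m D' : ℕ} (hm : Odd m) (hD : 67108864 * D' ^ 2 ≤ m) :
    512 * ((8 * D' + 8 * D') * m.choose (m / 2)) ≤ 2 ^ m := by
  have hc := choose_half_sq_mul_le hm
  have h4 : (2 ^ m) * (2 ^ m) = 4 ^ m := by rw [← pow_two, ← pow_mul, mul_comm, pow_mul]; norm_num
  have key : (512 * ((8 * D' + 8 * D') * m.choose (m / 2))) * (512 * ((8 * D' + 8 * D') * m.choose (m / 2))) ≤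
      (2 ^ m) * (2 ^ m) := by
    calc (512 * ((8 * D' + 8 * D') * m.choose (m / 2))) * (512 * ((8 * D' + 8 * D') * m.choose (m / 2)))
        = (67108864 * D' ^ 2) * (m.choose (m / 2)) ^ 2 := by ring
      _ ≤ m * (m.choose (m / 2)) ^ 2 := Nat.mul_le_mul_right _ hD
      _ = (m.choose (m / 2)) ^ 2 * m := by ring
      _ ≤ 4 ^ m := hc
      _ = (2 ^ m) * (2 ^ m) := h4.symm
  exact Nat.mul_self_le_mul_self_iff.1 key

/-- for large `n`: an odd block length `m` with `4m ≤ n` and `2^26·((log₂ n)^c)² ≤ m`. -/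
theorem exists_split4 (c : ℕ) : ∃ n₀ : ℕ, ∀ n ≥ n₀, ∃ m : ℕ, Odd m ∧ 3 ≤ m ∧ 4 * m ≤ n ∧
    67108864 * ((Nat.log 2 n) ^ c) ^ 2 ≤ m ∧ 64 ≤ n := by
  obtain ⟨n₁, hn₁⟩ := TubePlanProof.logPow_le_natSqrt (2 * c + 27)
  refine ⟨max n₁ 64, fun n hn => ?_⟩
  have hn1 : n₁ ≤ n := le_trans (le_max_left _ _) hn
  have h64 : 64 ≤ n := le_trans (le_max_right _ _) hn
  have hL : 2 ≤ Nat.log 2 n := Nat.le_log_of_pow_le (by norm_num) (le_trans (by norm_num) h64)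
  refine ⟨2 * (n / 8 - 1) + 1, ⟨n / 8 - 1, rfl⟩, by omega, by omega, ?_, h64⟩
  have hs := hn₁ n hn1
  have hsq : Nat.sqrt n * Nat.sqrt n ≤ n := Nat.sqrt_le n
  have h8 : 8 ≤ Nat.sqrt n := by rw [Nat.le_sqrt]; omega
  have h8s : 8 * Nat.sqrt n ≤ n := le_trans (Nat.mul_le_mul_right _ h8) hsq
  have hpow : 134217728 * ((Nat.log 2 n) ^ c) ^ 2 ≤ (Nat.log 2 n) ^ (2 * c + 27) := by
    rw [pow_add, ← pow_mul, mul_comm c 2]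
    have h27 : 134217728 ≤ (Nat.log 2 n) ^ 27 := by
      calc (134217728 : ℕ) = 2 ^ 27 := by norm_num
        _ ≤ (Nat.log 2 n) ^ 27 := Nat.pow_le_pow_left hL 27
    calc 134217728 * Nat.log 2 n ^ (2 * c) ≤ (Nat.log 2 n) ^ 27 * Nat.log 2 n ^ (2 * c) :=
        Nat.mul_le_mul_right _ h27
      _ = Nat.log 2 n ^ (2 * c) * Nat.log 2 n ^ 27 := mul_comm _ _
  omega

/-- **COROLLARY**: for every `c`, for all large `n`, every degree-`(log₂ n)^c` polynomial AGREES with the holonomy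
on at least `2^{n-6}` odd patterns. -/
theorem avoid_hard_polylog (c : ℕ) : ∃ n₀ : ℕ, ∀ n ≥ n₀, ∀ L : CubeFn (ZMod 3) n,
    L ∈ lowDeg (ZMod 3) n ((Nat.log 2 n) ^ c) →
      2 ^ (n - 1) ≤ 32 * (univ.filter fun x : Fin n → Bool => OddZeros x ∧ L x = ((hol x : ℕ) : ZMod 3)).card ∧
        64 ≤ n := by
  obtain ⟨n₀, hn₀⟩ := exists_split4 c
  refine ⟨n₀, fun n hn L hL => ?_⟩
  obtain ⟨m, hm, hm3, h4m, hD, h64⟩ := hn₀ n hn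
  exact ⟨avoid_count m L h4m hm hm3 (hK_of_sq hm hD) hL, h64⟩

/-- **crux `HolAvoidLoss3` PROVED** (exponent `C = 1`; in fact constant loss `2^{-5}`): no polylog-degree `𝔽₃`
polynomial avoids the holonomy trit on more than a `31/32` fraction of the odd class. -/
theorem holAvoidLoss3 : HolAvoidLoss3 := by
  refine ⟨1, fun c => ?_⟩
  obtain ⟨n₀, hn₀⟩ := avoid_hard_polylog c
  refine ⟨n₀, fun n hn L hL => ?_⟩
  obtain ⟨h, h64⟩ := hn₀ n hn L hL
  have hodd := card_odd_le (n := n) (by omega)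
  have hsplit : (univ.filter fun x : Fin n → Bool => OddZeros x ∧ L x = ((hol x : ℕ) : ZMod 3)).card +
      (univ.filter fun x : Fin n → Bool => OddZeros x ∧ L x ≠ ((hol x : ℕ) : ZMod 3)).card ≤
      (univ.filter fun x : Fin n → Bool => OddZeros x).card := by
    rw [← Finset.card_union_of_disjoint (Finset.disjoint_filter.2 fun x _ h1 h2 => h2.2 h1.2)]
    refine card_le_card fun x hx => ?_
    rw [mem_union, mem_filter, mem_filter] at hx
    rw [mem_filter]
    rcases hx with h | h
    · exact ⟨h.1, h.2.1⟩
    · exact ⟨h.1, h.2.1⟩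
  have hnat : 32 * (univ.filter fun x : Fin n → Bool => OddZeros x ∧ L x ≠ ((hol x : ℕ) : ZMod 3)).card + 2 ^ (n - 1) ≤
      32 * 2 ^ (n - 1) := by omega
  have hreal : (32 : ℝ) * ((univ.filter fun x : Fin n → Bool => OddZeros x ∧ L x ≠ ((hol x : ℕ) : ZMod 3)).card : ℝ) +
      (2 : ℝ) ^ (n - 1) ≤ 32 * (2 : ℝ) ^ (n - 1) := by exact_mod_cast hnat
  rw [pow_one]
  have hn' : (1 : ℝ) / (n : ℝ) ≤ 1 / 64 := by
    apply one_div_le_one_div_of_le (by norm_num)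
    exact_mod_cast h64
  have hpos : (0 : ℝ) ≤ (2 : ℝ) ^ (n - 1) := by positivity
  have hmul := mul_le_mul_of_nonneg_right hn' hpos
  nlinarith

/-- **node collapse**: with the crux proved the node equation reads `T ⟺ AvoidLift3` — the dial «SEPARATE ⊂ DECODE ⊂
AVOID ⊂ WIN» is EXHAUSTED below the task level WIN: every level short of winning the game is now a theorem. -/
theorem polyLossOddU3_iff_avoidLift3 : ExactnessDial.PolyLossOddU3 ↔ AvoidLift3 :=
  ⟨fun h _ => h, fun h => h holAvoidLoss3⟩

/-- the three dial levels below WIN, all PROVED. -/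
theorem dial_levels_proved : BinPointerLoss3 ∧ HolDecodeLoss3 ∧ HolAvoidLoss3 :=
  ⟨binPointerLoss3, holDecodeLoss3, holAvoidLoss3⟩

end Final

end AvoidHard

end HolonomyDial

end Summit.QuantumAdvantage.QuantumAdvantage.Theorems
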